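import Literature.Topology.FourManifolds.MMSWRasmussenFacts
import Literature.Topology.FourManifolds.DehnSurgery
import Summits.SmoothPoincare4.SmoothPoincare4.Theses.DottedCircleRasmussen
import Summits.SmoothPoincare4.SmoothPoincare4.Theorems.DottedCircleRasmussenDcrGapHelperFriendsCarrierVkHomotopyClause
import Summits.SmoothPoincare4.SmoothPoincare4.Theorems.DottedCircleRasmussenDcrGapHelperFriendsCarrierInversion
import Summits.SmoothPoincare4.SmoothPoincare4.Theorems.DottedCircleRasmussenDcrGapHelperFriendsPi1G1
import Summits.SmoothPoincare4.SmoothPoincare4.Theorems.DottedCircleRasmussenDcrGapHelperFriendsPi1G2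

/-!
# Helper `helper_friendsCarrier_Vk_transport` (piece 13 of the registered helper `helper_friendsCarrier_Vk`,
line `mk_friends`, skeleton v7) for crux `DcrGap`
(item stmt-SmoothPoincare4-16128, route route-SmoothPoincare4-DottedCircleRasmussen)

**Transport of an end collar of the model disc exterior through the chart at infinity.**  The registered
helper `helper_friendsCarrier_Vk` (V_k) asks for a `Y`-collar of the INVERTED model disc exterior
`F = {0} ∪ ι(E)`, `ι y = y/‖y‖²`, `E = ℝ⁴ ∖ (D_k ∪ Δ₁)`, with its end clauses (sublevel images closed,
complement of the target united with superlevel images compact) and the homotopy clause (the collar loop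
`c(μ₁ ·, 0)` controls the inverted tube meridian `ι(T(0, v/2))`).  The collar is naturally BUILT in the
uninverted exterior `E` (the `k = 0` template `SliceDiscEndCollar.lean` builds it in `B̊⁴ ∖ Δ`), for a
reparametrised disc `g₁` with the same image `g₁(𝔻²) = f₁(𝔻²)` and a trivialised tube `G₁` of it whose
meridian `G₁(0, v/2)` is the collar loop.  This file proves, once and for all, the passage `E ⇒ F`:
from an `E`-collar `cE : Y × ℝ ≅ (open subset of E)` which is `C^∞` with `C^∞` inverse, whose sublevel
images `cE(Y × (-∞, a])` are closed in `E`, whose "core ∪ superlevel" sets are closed IN `ℝ⁴`, whose image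
is bounded, and whose core loop is the tube meridian of `G₁`, the collar `c = ι ∘ cE` of `F` has every
clause of V_k:

* smoothness both ways (the inversion is a partial diffeomorphism `E ⇀ F` onto `F ∖ {0}`, as in the
  landed `helper_friendsCarrier_inversion`);
* `c(Y × (-∞, a])` is closed in `F` (a closed subset of `E` bounded in `ℝ⁴` inverts to a subset of
  `F ∖ {0}` bounded away from `0`);
* `c.targetᶜ ∪ c(Y × [a, ∞)) = {0} ∪ ι(closed subset of ℝ⁴ inside E)` is compact (closed and bounded in
  `ℝ⁴`: `E` misses a ball about `0 ∈ D_k°`);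
* the homotopy clause, by the landed reduction `helper_friendsCarrier_Vk_homotopyClause` fed with
  Kervaire's property of the meridian loop `G₁(0, v/2)` of `E` — the landed Kervaire lemma
  `helper_friendsPi1_G2` (with `helper_friendsPi1_G1`: `ℝ⁴ ∖ D_k` is simply connected) applied to the
  disc `g₁` and its tube `G₁`, which have the same exterior `E`.

No definitions, no named facts, no `sorry`.

## References

* A. A. Kosinski, *Differential Manifolds* (1993), Ch. VI §5 (ends, collars, the inversion chart). [Kosinski1993]
* M. Kervaire, *Les nœuds de dimensions supérieures*, Bull. SMF 93 (1965), Ch. I Lemme 1.2. [KervaireBSMF1965]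
-/

-- the prescribed namespace `Summit.<P>.<Sub>.…` duplicates `SmoothPoincare4` (P = Sub)
set_option linter.dupNamespace false
set_option linter.style.longLine false

noncomputable section

open scoped Manifold ContDiff Topology
open Function Set Metric TopologicalSpace
open Literature.Topology.FourManifolds Literature.Topology.FourManifolds.MMSW
open Literature.AlgebraicTopology.Homotopy.HopfFibration

namespace Summit.SmoothPoincare4.SmoothPoincare4.Theorems.DcrGap.MkFriends

namespace FriendsCarrierVk

/-! ## A ball about the origin inside the model handlebody -/

/-- **`0` is an interior point of `D_k`**: a ball about the origin lies in the model handlebody (the guard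
is `> 1` and `G_k < 1` near `0`, both being continuous there, and `G_k(0) = Σ_j 1/(16(j+1)²) < 1`). [folklore] -/
theorem exists_ball_subset_modelHandlebody (k : ℕ) :
    ∃ d : ℝ, 0 < d ∧ ∀ x : EuclideanSpace ℝ (Fin 4), ‖x‖ < d → x ∈ modelHandlebody k := by
  have hhole : ∀ j : Fin k, holeTerm k j 0 = 16 * (((j : ℕ) : ℝ) + 1) ^ 2 := fun j => by
    simp only [holeTerm, PiLp.zero_apply]
    ring
  have hguard0 : ∀ j : Fin k, (1 : ℝ) < holeTerm k j 0 := fun j => by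
    rw [hhole]
    nlinarith [sq_nonneg (((j : ℕ) : ℝ)), (Nat.cast_nonneg (j : ℕ) : (0 : ℝ) ≤ _)]
  have hG0 : levelFun k 0 < 1 := by
    have hG : levelFun k 0 = ∑ i ∈ Finset.range k, 1 / (16 * (((i : ℕ) : ℝ) + 1) ^ 2) := by
      unfold levelFun
      simp only [PiLp.zero_apply, hhole]
      rw [← Fin.sum_univ_eq_sum_range (fun i => 1 / (16 * (((i : ℕ) : ℝ) + 1) ^ 2)) k]
      ring
    rw [hG]
    have hk : (0 : ℝ) < 2 / ((k : ℝ) + 1) := by positivity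
    have := sum_inv_sixteen_sq_le k
    linarith
  -- the open set `{guard > 1} ∩ {G_k < 1}` contains `0`
  set U : Set (EuclideanSpace ℝ (Fin 4)) := {x | ∀ j : Fin k, 1 < holeTerm k j x} with hU
  have hUo : IsOpen U := isOpen_guard 1
  have hc : ContinuousOn (levelFun k) U :=
    (continuousOn_levelFun (one_pos : (0 : ℝ) < 1)).mono fun x hx j => (hx j).le
  have hVo : IsOpen (U ∩ levelFun k ⁻¹' Iio 1) := hc.isOpen_inter_preimage hUo isOpen_Iio
  have h0V : (0 : EuclideanSpace ℝ (Fin 4)) ∈ U ∩ levelFun k ⁻¹' Iio 1 := ⟨hguard0, hG0⟩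
  obtain ⟨d, hd, hball⟩ := Metric.isOpen_iff.1 hVo 0 h0V
  refine ⟨d, hd, fun x hx => ?_⟩
  have hxV : x ∈ U ∩ levelFun k ⁻¹' Iio 1 := hball (mem_ball_zero_iff.2 hx)
  exact ⟨fun j => (hxV.1 j).le, (le_of_lt hxV.2)⟩

/-! ## The inversion `E ⇀ F` as a partial diffeomorphism -/

/-- **The chart at infinity as a partial diffeomorphism** `Ψ : E ⇀ F`, `Ψ a = a/‖a‖²`: source `E`, target
`F ∖ {0}`, inverse the inversion again, `C^∞` both ways (the construction of the landed
`helper_friendsCarrier_inversion`, with the inverse exposed). [cite: Kosinski1993, Ch. VI §5] -/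
theorem exists_inversion {k : ℕ} {f₁ : EuclideanSpace ℝ (Fin 2) → EuclideanSpace ℝ (Fin 4)}
    {E F : Opens (EuclideanSpace ℝ (Fin 4))}
    (hE : (E : Set (EuclideanSpace ℝ (Fin 4))) = {x | x ∉ modelHandlebody k ∧ x ∉ f₁ '' closedBall 0 1})
    (hF : (F : Set (EuclideanSpace ℝ (Fin 4))) = {0} ∪ {y : EuclideanSpace ℝ (Fin 4) | y ≠ 0 ∧
      (‖y‖ ^ 2)⁻¹ • y ∉ modelHandlebody k ∧ (‖y‖ ^ 2)⁻¹ • y ∉ f₁ '' closedBall 0 1})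
    (a₀ : E) :
    ∃ Ψ : OpenPartialHomeomorph E F, Ψ.source = univ ∧ Ψ.target = {z : F | (z : EuclideanSpace ℝ (Fin 4)) ≠ 0} ∧
      (∀ a : E, ((Ψ a : F) : EuclideanSpace ℝ (Fin 4)) = (‖(a : EuclideanSpace ℝ (Fin 4))‖ ^ 2)⁻¹ • (a : EuclideanSpace ℝ (Fin 4))) ∧
      (∀ z : F, (z : EuclideanSpace ℝ (Fin 4)) ≠ 0 →
        ((Ψ.symm z : E) : EuclideanSpace ℝ (Fin 4)) = (‖(z : EuclideanSpace ℝ (Fin 4))‖ ^ 2)⁻¹ • (z : EuclideanSpace ℝ (Fin 4))) ∧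
      ContMDiffOn (𝓡 4) (𝓡 4) ∞ Ψ Ψ.source ∧ ContMDiffOn (𝓡 4) (𝓡 4) ∞ Ψ.symm Ψ.target := by
  set inv : EuclideanSpace ℝ (Fin 4) → EuclideanSpace ℝ (Fin 4) := fun y => (‖y‖ ^ 2)⁻¹ • y with hinv
  have hinvinv : ∀ {y : EuclideanSpace ℝ (Fin 4)}, y ≠ 0 → inv (inv y) = y := fun hy =>
    inv_normSq_smul_inv_normSq_smul hy
  have hinvne : ∀ {y : EuclideanSpace ℝ (Fin 4)}, y ≠ 0 → inv y ≠ 0 := fun hy => inv_normSq_smul_ne_zero hy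
  have hmemE : ∀ {x : EuclideanSpace ℝ (Fin 4)}, x ∈ (E : Set (EuclideanSpace ℝ (Fin 4))) ↔
      x ∉ modelHandlebody k ∧ x ∉ f₁ '' closedBall (0 : EuclideanSpace ℝ (Fin 2)) 1 := fun {x} => by
    rw [hE]; rfl
  have hmemF : ∀ {y : EuclideanSpace ℝ (Fin 4)}, y ∈ (F : Set (EuclideanSpace ℝ (Fin 4))) ↔
      y = 0 ∨ (y ≠ 0 ∧ inv y ∉ modelHandlebody k ∧ inv y ∉ f₁ '' closedBall (0 : EuclideanSpace ℝ (Fin 2)) 1) :=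
    fun {y} => by rw [hF]; simp [hinv]
  have hEne : ∀ a : E, (a : EuclideanSpace ℝ (Fin 4)) ≠ 0 := fun a ha =>
    (hmemE.1 a.2).1 (ha ▸ zero_mem_modelHandlebody k)
  have hιmem : ∀ a : E, inv (a : EuclideanSpace ℝ (Fin 4)) ∈ F := fun a =>
    hmemF.2 (Or.inr ⟨hinvne (hEne a), by rw [hinvinv (hEne a)]; exact (hmemE.1 a.2).1,
      by rw [hinvinv (hEne a)]; exact (hmemE.1 a.2).2⟩)
  have hFmem : ∀ z : F, (z : EuclideanSpace ℝ (Fin 4)) ≠ 0 → inv (z : EuclideanSpace ℝ (Fin 4)) ∈ E :=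
    fun z hz => by
      rcases hmemF.1 z.2 with h0 | ⟨-, h1, h2⟩
      · exact absurd h0 hz
      · exact hmemE.2 ⟨h1, h2⟩
  classical
  set Ψ : OpenPartialHomeomorph E F :=
    { toFun := fun a => ⟨inv (a : EuclideanSpace ℝ (Fin 4)), hιmem a⟩
      invFun := fun z => if hz : (z : EuclideanSpace ℝ (Fin 4)) ≠ 0 then ⟨inv z, hFmem z hz⟩ else a₀
      source := univ
      target := {z : F | (z : EuclideanSpace ℝ (Fin 4)) ≠ 0}
      map_source' := fun a _ => hinvne (hEne a)
      map_target' := fun _ _ => mem_univ _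
      left_inv' := fun a _ => by
        have hne : inv (a : EuclideanSpace ℝ (Fin 4)) ≠ 0 := hinvne (hEne a)
        rw [dif_pos hne]
        exact Subtype.ext (hinvinv (hEne a))
      right_inv' := fun z hz => by
        rw [dif_pos (show (z : EuclideanSpace ℝ (Fin 4)) ≠ 0 from hz)]
        exact Subtype.ext (hinvinv hz)
      open_source := isOpen_univ
      open_target := isOpen_ne.preimage continuous_subtype_val
      continuousOn_toFun := by
        refine Continuous.continuousOn (Continuous.subtype_mk ?_ _)
        exact continuous_iff_continuousAt.2 fun a =>
          (contDiffAt_inv_normSq_smul (hEne a)).continuousAt.comp continuous_subtype_val.continuousAt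
      continuousOn_invFun := by
        intro z hz
        refine ContinuousAt.continuousWithinAt ?_
        have hev : (Subtype.val ∘ fun z : F => if hz : (z : EuclideanSpace ℝ (Fin 4)) ≠ 0 then
            (⟨inv z, hFmem z hz⟩ : E) else a₀) =ᶠ[𝓝 z] fun z => inv (z : EuclideanSpace ℝ (Fin 4)) := by
          filter_upwards [(isOpen_ne.preimage continuous_subtype_val).mem_nhds hz] with w hw
          simp only [comp_apply, dif_pos (show (w : EuclideanSpace ℝ (Fin 4)) ≠ 0 from hw)]
        have hcomp : ContinuousAt (fun w : F => inv (w : EuclideanSpace ℝ (Fin 4))) z :=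
          (contDiffAt_inv_normSq_smul hz).continuousAt.comp continuous_subtype_val.continuousAt
        exact Topology.IsInducing.subtypeVal.continuousAt_iff.2 ((continuousAt_congr hev).2 hcomp) }
    with hΨdef
  have hsymm_apply : ∀ z : F, (z : EuclideanSpace ℝ (Fin 4)) ≠ 0 →
      ((Ψ.symm z : E) : EuclideanSpace ℝ (Fin 4)) = inv (z : EuclideanSpace ℝ (Fin 4)) := fun z hz => by
    have : Ψ.symm z = ⟨inv z, hFmem z hz⟩ := dif_pos hz
    rw [this]
  refine ⟨Ψ, rfl, rfl, fun a => rfl, hsymm_apply, ?_, ?_⟩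
  · intro a _
    refine ContMDiffAt.contMDiffWithinAt ?_
    rw [← ContMDiffAt.subtypeVal_comp_iff]
    exact ((contDiffAt_inv_normSq_smul (hEne a)).contMDiffAt).comp a contMDiff_subtype_val.contMDiffAt
  · intro z hz
    have hz' : (z : EuclideanSpace ℝ (Fin 4)) ≠ 0 := hz
    refine ContMDiffAt.contMDiffWithinAt ?_
    rw [← ContMDiffAt.subtypeVal_comp_iff]
    have hev : (Subtype.val ∘ Ψ.symm) =ᶠ[𝓝 z] fun z => inv (z : EuclideanSpace ℝ (Fin 4)) := by
      filter_upwards [(isOpen_ne.preimage continuous_subtype_val).mem_nhds hz'] with w hw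
      exact hsymm_apply w hw
    refine ContMDiffAt.congr_of_eventuallyEq ?_ hev
    exact ((contDiffAt_inv_normSq_smul hz').contMDiffAt).comp z contMDiff_subtype_val.contMDiffAt

/-! ## Images of closed sets under the inversion -/

/-- **A closed subset of `E` which is bounded in `ℝ⁴` inverts to a closed subset of `F`.** [folklore] -/
theorem isClosed_image_inversion {E F : Opens (EuclideanSpace ℝ (Fin 4))} (Ψ : OpenPartialHomeomorph E F)
    (hΨsrc : Ψ.source = univ) (hΨtgt : Ψ.target = {z : F | (z : EuclideanSpace ℝ (Fin 4)) ≠ 0})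
    (hΨval : ∀ a : E, ((Ψ a : F) : EuclideanSpace ℝ (Fin 4)) = (‖(a : EuclideanSpace ℝ (Fin 4))‖ ^ 2)⁻¹ • (a : EuclideanSpace ℝ (Fin 4)))
    (hEne : ∀ a : E, (a : EuclideanSpace ℝ (Fin 4)) ≠ 0)
    {A : Set E} (hA : IsClosed A) {R : ℝ} (hR : ∀ a ∈ A, ‖(a : EuclideanSpace ℝ (Fin 4))‖ ≤ R) :
    IsClosed (Ψ '' A) := by
  -- the image stays away from `0`
  have hfar : Ψ '' A ⊆ {z : F | R⁻¹ ≤ ‖(z : EuclideanSpace ℝ (Fin 4))‖} := by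
    rintro _ ⟨a, ha, rfl⟩
    show R⁻¹ ≤ ‖((Ψ a : F) : EuclideanSpace ℝ (Fin 4))‖
    rw [hΨval, norm_inv_normSq_smul]
    have h0 : 0 < ‖(a : EuclideanSpace ℝ (Fin 4))‖ := norm_pos_iff.2 (hEne a)
    exact inv_anti₀ h0 (hR a ha)
  have hfarc : IsClosed {z : F | R⁻¹ ≤ ‖(z : EuclideanSpace ℝ (Fin 4))‖} :=
    isClosed_le continuous_const (continuous_norm.comp continuous_subtype_val)
  refine isClosed_of_closure_subset fun z hz => ?_
  have hzfar : R⁻¹ ≤ ‖(z : EuclideanSpace ℝ (Fin 4))‖ := (closure_minimal hfar hfarc) hz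
  -- so `z ≠ 0`, i.e. `z ∈ Ψ.target`
  have hAne : A.Nonempty := by
    by_contra h
    rw [not_nonempty_iff_eq_empty] at h
    rw [h, image_empty, closure_empty] at hz
    exact hz
  obtain ⟨a₁, ha₁⟩ := hAne
  have hRpos : 0 < R := lt_of_lt_of_le (norm_pos_iff.2 (hEne a₁)) (hR a₁ ha₁)
  have hz0 : (z : EuclideanSpace ℝ (Fin 4)) ≠ 0 := fun h => by
    rw [h, norm_zero] at hzfar
    exact absurd hzfar (not_le.2 (inv_pos.2 hRpos))
  have hzt : z ∈ Ψ.target := by rw [hΨtgt]; exact hz0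
  -- `Ψ.symm z ∈ closure A = A` by continuity of `Ψ.symm` at `z`
  have himg : Ψ '' A = Ψ.target ∩ Ψ.symm ⁻¹' A :=
    Ψ.image_eq_target_inter_inv_preimage (by rw [hΨsrc]; exact subset_univ _)
  have hcont : ContinuousWithinAt Ψ.symm (Ψ '' A) z :=
    (Ψ.continuousOn_symm z hzt).mono (by rw [himg]; exact inter_subset_left)
  have hmem : Ψ.symm z ∈ closure (Ψ.symm '' (Ψ '' A)) := hcont.mem_closure_image hz
  have hAA : Ψ.symm '' (Ψ '' A) = A := by
    rw [← image_comp]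
    have : ∀ a ∈ A, (Ψ.symm ∘ Ψ) a = a := fun a _ => Ψ.left_inv (by rw [hΨsrc]; exact mem_univ a)
    rw [image_congr this, image_id']
  rw [hAA, hA.closure_eq] at hmem
  exact ⟨Ψ.symm z, hmem, Ψ.right_inv hzt⟩

/-- **`{0} ∪ ι(T)` is compact** for a subset `T ⊆ E` closed in `ℝ⁴` (bounded by `1/d` where `B(0, d) ⊆ D_k`
misses `E`; closed because its only new limit point is `0`). [folklore] -/
theorem isCompact_zero_union_inversion {Tv : Set (EuclideanSpace ℝ (Fin 4))} (hT : IsClosed Tv)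
    {d : ℝ} (hd : 0 < d) (hdT : ∀ x ∈ Tv, d ≤ ‖x‖) :
    IsCompact ({0} ∪ (fun y : EuclideanSpace ℝ (Fin 4) => (‖y‖ ^ 2)⁻¹ • y) '' Tv) := by
  set inv : EuclideanSpace ℝ (Fin 4) → EuclideanSpace ℝ (Fin 4) := fun y => (‖y‖ ^ 2)⁻¹ • y with hinv
  have hT0 : ∀ x ∈ Tv, x ≠ 0 := fun x hx h => by
    have := hdT x hx; rw [h, norm_zero] at this; linarith
  refine Metric.isCompact_of_isClosed_isBounded ?_ ?_
  · -- closed: a limit point `z ≠ 0` of `inv '' Tv` is `inv (inv z)` with `inv z ∈ closure Tv = Tv`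
    refine isClosed_of_closure_subset fun z hz => ?_
    by_cases hz0 : z = 0
    · exact Or.inl hz0
    right
    rw [closure_union, closure_singleton] at hz
    rcases hz with hz | hz
    · exact absurd hz hz0
    have hcont : ContinuousWithinAt inv (inv '' Tv) z := (contDiffAt_inv_normSq_smul hz0).continuousAt.continuousWithinAt
    have hmem : inv z ∈ closure (inv '' (inv '' Tv)) := hcont.mem_closure_image hz
    have hII : inv '' (inv '' Tv) = Tv := by
      rw [← image_comp]
      have : ∀ x ∈ Tv, (inv ∘ inv) x = x := fun x hx => inv_normSq_smul_inv_normSq_smul (hT0 x hx)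
      rw [image_congr this, image_id']
    rw [hII, hT.closure_eq] at hmem
    exact ⟨inv z, hmem, inv_normSq_smul_inv_normSq_smul hz0⟩
  · -- bounded by `1/d`
    refine (isBounded_closedBall (x := (0 : EuclideanSpace ℝ (Fin 4))) (r := d⁻¹)).subset ?_
    rintro z (hz | ⟨x, hx, rfl⟩)
    · rw [mem_singleton_iff.1 hz]; simp [hd.le]
    · rw [mem_closedBall_zero_iff]
      show ‖(‖x‖ ^ 2)⁻¹ • x‖ ≤ d⁻¹
      rw [norm_inv_normSq_smul]
      exact inv_anti₀ hd (hdT x hx)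

end FriendsCarrierVk

open FriendsCarrierVk in
/-- **Helper `helper_friendsCarrier_Vk_transport`** (registered piece of `helper_friendsCarrier_Vk`: transport of an
end collar through the chart at infinity).  Let `f₁` be a model slice disc of the model knot `K₁` with
trivialised tube `T`, let `g₁` be a model slice disc with the same image `g₁(𝔻²) = f₁(𝔻²)` and `G₁` a
trivialised tube of `g₁` off `D_k`, and let `E`, `F` be the model disc exterior and its inversion (as
`Opens ℝ⁴`, by their defining equations).  If `cE : Y × ℝ ⇀ E` is a globally defined partial diffeomorphism
(`C^∞` with `C^∞` inverse) whose sublevel images `cE(Y × (-∞, a])` are closed in `E`, whose sets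
`(cE.target)ᶜ ∪ cE(Y × [a, ∞))` are closed in `ℝ⁴`, whose image is bounded, and whose core loop
`cE(μ₁ v, 0)` is the tube meridian `G₁(0, v/2)`, then `c = ι ∘ cE` is a collar of `F` with all the clauses of
`helper_friendsCarrier_Vk`: `C^∞` both ways, `c(Y × (-∞, a])` closed, `c.targetᶜ ∪ c(Y × [a, ∞))` compact,
and the collar loop `c(μ₁ ·, 0)` controls the inverted tube meridian `ι(T(0, v/2))` under every map
`F → Z` (Kervaire: `helper_friendsPi1_G2`, `helper_friendsPi1_G1`, `helper_friendsCarrier_Vk_homotopyClause`).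
[cite: Kosinski1993, Ch. VI §5] -/
theorem helper_friendsCarrier_Vk_transport : ∀ (k : ℕ) (K₁ : (sphere (0 : EuclideanSpace ℝ (Fin 2)) 1) → EuclideanSpace ℝ (Fin 4)) (f₁ : EuclideanSpace ℝ (Fin 2) → EuclideanSpace ℝ (Fin 4)) (T : EuclideanSpace ℝ (Fin 2) × EuclideanSpace ℝ (Fin 2) → EuclideanSpace ℝ (Fin 4)), IsModelKnot k K₁ → IsModelSliceDisc k K₁ f₁ → (ContDiffOn ℝ ∞ T (ball 0 1 ×ˢ ball 0 2) ∧ InjOn T (ball 0 1 ×ˢ ball 0 2) ∧ (∀ q ∈ ball 0 1 ×ˢ ball 0 2, Injective (fderiv ℝ T q)) ∧ (∀ q ∈ ball 0 1 ×ˢ ball 0 2, T q ∉ modelHandlebody k) ∧ (∀ x ∈ ball 0 1, T (x, 0) = f₁ x)) → ∀ (g₁ : EuclideanSpace ℝ (Fin 2) → EuclideanSpace ℝ (Fin 4)) (G₁ : EuclideanSpace ℝ (Fin 2) × EuclideanSpace ℝ (Fin 2) → EuclideanSpace ℝ (Fin 4)), IsModelSliceDisc k K₁ g₁ → g₁ ''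 closedBall 0 1 = f₁ '' closedBall 0 1 → (ContDiffOn ℝ ∞ G₁ (ball 0 1 ×ˢ ball 0 2) ∧ InjOn G₁ (ball 0 1 ×ˢ ball 0 2) ∧ (∀ q ∈ ball 0 1 ×ˢ ball 0 2, Injective (fderiv ℝ G₁ q)) ∧ (∀ q ∈ ball 0 1 ×ˢ ball 0 2, G₁ q ∉ modelHandlebody k) ∧ (∀ x ∈ ball 0 1, G₁ (x, 0) = g₁ x)) → ∀ (Y : Type) [TopologicalSpace Y] [ChartedSpace (EuclideanSpace ℝ (Fin 3)) Y] (μ₁ : C((sphere (0 : EuclideanSpace ℝ (Fin 2)) 1), Y)) (E F : Opens (EuclideanSpace ℝ (Fin 4))), (E : Set (EuclideanSpace ℝ (Fin 4))) = {x | x ∉ modelHandlebody k ∧ x ∉ f₁ '' closedBall 0 1} → (F : Set (EuclideanSpace ℝ (Fin 4))) = {0} ∪ {y : EuclideanSpace ℝ (Fin 4) | y ≠ 0 ∧ (‖y‖ ^ 2)⁻¹ • y ∉ modelHandlebody k ∧ (‖y‖ ^ 2)⁻¹ • y ∉ f₁ '' closedBall 0 1} → ∀ (cE : OpenPartialHomeomorph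 (Y × ℝ) E) (R : ℝ), cE.source = univ → ContMDiffOn ((𝓡 3).prod 𝓘(ℝ, ℝ)) (𝓡 4) ∞ cE cE.source → ContMDiffOn (𝓡 4) ((𝓡 3).prod 𝓘(ℝ, ℝ)) ∞ cE.symm cE.target → (∀ a : ℝ, IsClosed (cE '' {q | q.2 ≤ a})) → (∀ a : ℝ, IsClosed (((↑) : E → EuclideanSpace ℝ (Fin 4)) '' (cE.targetᶜ ∪ cE '' {q | a ≤ q.2}))) → (∀ q : Y × ℝ, ‖((cE q : E) : EuclideanSpace ℝ (Fin 4))‖ ≤ R) → (∀ v : (sphere (0 : EuclideanSpace ℝ (Fin 2)) 1), ((cE (μ₁ v, 0) : E) : EuclideanSpace ℝ (Fin 4)) = G₁ (0, (1 / 2 : ℝ) • (v : EuclideanSpace ℝ (Fin 2)))) → ∃ c : OpenPartialHomeomorph (Y × ℝ) F, c.source = univ ∧ ContMDiffOn ((𝓡 3).prod 𝓘(ℝ, ℝ)) (𝓡 4) ∞ c c.source ∧ ContMDiffOn (𝓡 4) ((𝓡 3).prod 𝓘(ℝ, ℝ)) ∞ c.symm c.target ∧ (∀ a : ℝ, IsClosed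 (c '' {q | q.2 ≤ a})) ∧ (∀ a : ℝ, IsCompact (c.targetᶜ ∪ c '' {q | a ≤ q.2})) ∧ ∀ (L₁ L₂ : C((sphere (0 : EuclideanSpace ℝ (Fin 2)) 1), F)), (∀ v, L₁ v = c (μ₁ v, 0)) → (∀ v : (sphere (0 : EuclideanSpace ℝ (Fin 2)) 1), ((L₂ v : F) : EuclideanSpace ℝ (Fin 4)) = (‖T ((0 : EuclideanSpace ℝ (Fin 2)), (1 / 2 : ℝ) • (v : EuclideanSpace ℝ (Fin 2)))‖ ^ 2)⁻¹ • T ((0 : EuclideanSpace ℝ (Fin 2)), (1 / 2 : ℝ) • (v : EuclideanSpace ℝ (Fin 2)))) → ∀ (Z : Type) [TopologicalSpace Z] (g : C(F, Z)), (∃ z : Z, (g.comp L₁).Homotopic (ContinuousMap.const (sphere (0 : EuclideanSpace ℝ (Fin 2)) 1) z)) → ∃ z : Z, (g.comp L₂).Homotopic (ContinuousMap.const (sphere (0 : EuclideanSpace ℝ (Fin 2)) 1) z) := by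
  intro k K₁ f₁ T hK hf hT g₁ G₁ hg hgf hG Y _ _ μ₁ E F hE hF cE R hsrc hcs hcs' hcl hcl' hR hcore
  -- membership bookkeeping
  have hmemE : ∀ {x : EuclideanSpace ℝ (Fin 4)}, x ∈ (E : Set (EuclideanSpace ℝ (Fin 4))) ↔
      x ∉ modelHandlebody k ∧ x ∉ f₁ '' closedBall (0 : EuclideanSpace ℝ (Fin 2)) 1 := fun {x} => by
    rw [hE]; rfl
  have hmemF : ∀ {y : EuclideanSpace ℝ (Fin 4)}, y ∈ (F : Set (EuclideanSpace ℝ (Fin 4))) ↔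
      y = 0 ∨ (y ≠ 0 ∧ (‖y‖ ^ 2)⁻¹ • y ∉ modelHandlebody k ∧ (‖y‖ ^ 2)⁻¹ • y ∉ f₁ '' closedBall (0 : EuclideanSpace ℝ (Fin 2)) 1) :=
    fun {y} => by rw [hF]; simp
  have hEne : ∀ a : E, (a : EuclideanSpace ℝ (Fin 4)) ≠ 0 := fun a ha =>
    (hmemE.1 a.2).1 (ha ▸ zero_mem_modelHandlebody k)
  have h0F : (0 : EuclideanSpace ℝ (Fin 4)) ∈ (F : Set (EuclideanSpace ℝ (Fin 4))) := hmemF.2 (Or.inl rfl)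
  obtain ⟨d, hd, hdD⟩ := exists_ball_subset_modelHandlebody k
  have hEd : ∀ x ∈ (E : Set (EuclideanSpace ℝ (Fin 4))), d ≤ ‖x‖ := fun x hx =>
    not_lt.1 fun h => (hmemE.1 hx).1 (hdD x h)
  -- the chart at infinity
  obtain ⟨v₀⟩ : Nonempty (sphere (0 : EuclideanSpace ℝ (Fin 2)) 1) :=
    (NormedSpace.sphere_nonempty.2 zero_le_one).to_subtype
  obtain ⟨Ψ, hΨsrc, hΨtgt, hΨval, hΨsymm, hΨs, hΨs'⟩ := exists_inversion hE hF (cE (μ₁ v₀, 0))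
  -- the collar of `F`
  set c : OpenPartialHomeomorph (Y × ℝ) F := cE.trans Ψ with hc
  have hccoe : (c : Y × ℝ → F) = Ψ ∘ cE := OpenPartialHomeomorph.coe_trans _ _
  have hcsrc : c.source = univ := by
    rw [hc, OpenPartialHomeomorph.trans_source, hsrc, hΨsrc, preimage_univ, inter_univ]
  have hctgt : c.target = Ψ.target ∩ Ψ.symm ⁻¹' cE.target := OpenPartialHomeomorph.trans_target _ _
  refine ⟨c, hcsrc, ?_, ?_, ?_, ?_, ?_⟩
  · -- `C^∞`
    rw [hcsrc, hccoe]
    have h1 : ContMDiff ((𝓡 3).prod 𝓘(ℝ, ℝ)) (𝓡 4) ∞ cE := by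
      have h := hcs; rw [hsrc] at h; exact contMDiffOn_univ.1 h
    have h2 : ContMDiff (𝓡 4) (𝓡 4) ∞ Ψ := by
      have h := hΨs; rw [hΨsrc] at h; exact contMDiffOn_univ.1 h
    exact (h2.comp h1).contMDiffOn
  · -- `C^∞` inverse on the target
    rw [hctgt, hc, OpenPartialHomeomorph.coe_trans_symm]
    exact hcs'.comp (hΨs'.mono inter_subset_left) fun z hz => hz.2
  · -- sublevel images are closed in `F`
    intro a
    rw [hccoe, image_comp]
    exact isClosed_image_inversion Ψ hΨsrc hΨtgt hΨval hEne (hcl a) (R := R)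
      (by rintro _ ⟨q, -, rfl⟩; exact hR q)
  · -- `c.targetᶜ ∪ c(Y × [a, ∞))` is compact
    intro a
    set T₀ : Set E := cE.targetᶜ ∪ cE '' {q | a ≤ q.2} with hT₀
    have hK : c.targetᶜ ∪ c '' {q | a ≤ q.2} = {z : F | (z : EuclideanSpace ℝ (Fin 4)) = 0} ∪ Ψ '' T₀ := by
      ext z
      constructor
      · rintro (hz | ⟨q, hq, rfl⟩)
        · by_cases hz0 : (z : EuclideanSpace ℝ (Fin 4)) = 0
          · exact Or.inl hz0
          · have hzt : z ∈ Ψ.target := by rw [hΨtgt]; exact hz0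
            refine Or.inr ⟨Ψ.symm z, Or.inl fun h => hz ?_, Ψ.right_inv hzt⟩
            rw [hctgt]; exact ⟨hzt, h⟩
        · exact Or.inr ⟨cE q, Or.inr ⟨q, hq, rfl⟩, by rw [hccoe]; rfl⟩
      · rintro (hz | ⟨t, ht, rfl⟩)
        · refine Or.inl fun h => ?_
          rw [hctgt, hΨtgt] at h
          exact h.1 hz
        · rcases ht with ht | ⟨q, hq, rfl⟩
          · refine Or.inl fun h => ht ?_
            rw [hctgt] at h
            have := h.2
            rwa [mem_preimage, Ψ.left_inv (by rw [hΨsrc]; exact mem_univ t)] at this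
          · exact Or.inr ⟨q, hq, by rw [hccoe]; rfl⟩
    have hcpt := isCompact_zero_union_inversion (hcl' a) hd fun x hx => hEd x (by
      obtain ⟨t, -, rfl⟩ := hx
      exact t.2)
    rw [Topology.IsInducing.subtypeVal.isCompact_iff]
    convert hcpt using 1
    rw [hK, image_union]
    congr 1
    · ext y
      simp only [mem_image, mem_singleton_iff]
      constructor
      · rintro ⟨z, hz, rfl⟩; exact hz
      · rintro rfl; exact ⟨⟨0, h0F⟩, rfl, rfl⟩
    · ext y
      simp only [mem_image]
      constructor
      · rintro ⟨_, ⟨t, ht, rfl⟩, rfl⟩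
        exact ⟨t, ⟨t, ht, rfl⟩, (hΨval t).symm⟩
      · rintro ⟨_, ⟨t, ht, rfl⟩, rfl⟩
        exact ⟨Ψ t, ⟨t, ht, rfl⟩, hΨval t⟩
  · -- the homotopy clause: Kervaire's property of the meridian of `G₁`
    intro L₁ L₂ hL₁ hL₂ Z _ g hgL
    have hE' : (E : Set (EuclideanSpace ℝ (Fin 4))) = {x | x ∉ modelHandlebody k ∧ x ∉ g₁ '' closedBall 0 1} := by
      rw [hE, hgf]
    have hμmem : ∀ v : sphere (0 : EuclideanSpace ℝ (Fin 2)) 1,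
        G₁ ((0 : EuclideanSpace ℝ (Fin 2)), (1 / 2 : ℝ) • (v : EuclideanSpace ℝ (Fin 2))) ∈ (E : Set (EuclideanSpace ℝ (Fin 4))) :=
      fun v => by
        rw [hE']
        exact tubeMeridian_mem_exterior hK hg hG.2.1 hG.2.2.2.1 hG.2.2.2.2 v
    have hμc : Continuous fun v : sphere (0 : EuclideanSpace ℝ (Fin 2)) 1 =>
        G₁ ((0 : EuclideanSpace ℝ (Fin 2)), (1 / 2 : ℝ) • (v : EuclideanSpace ℝ (Fin 2))) := by
      have hmaps : ∀ v : sphere (0 : EuclideanSpace ℝ (Fin 2)) 1,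
          ((0 : EuclideanSpace ℝ (Fin 2)), (1 / 2 : ℝ) • (v : EuclideanSpace ℝ (Fin 2))) ∈
            ball (0 : EuclideanSpace ℝ (Fin 2)) 1 ×ˢ ball (0 : EuclideanSpace ℝ (Fin 2)) 2 := fun v => by
        refine ⟨by simp, ?_⟩
        rw [mem_ball_zero_iff, norm_smul, norm_eq_of_mem_sphere, mul_one, Real.norm_eq_abs,
          abs_of_pos (by norm_num)]
        norm_num
      exact hG.1.continuousOn.comp_continuous (by fun_prop) hmaps
    set L₁' : C((sphere (0 : EuclideanSpace ℝ (Fin 2)) 1), E) :=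
      ⟨fun v => ⟨G₁ ((0 : EuclideanSpace ℝ (Fin 2)), (1 / 2 : ℝ) • (v : EuclideanSpace ℝ (Fin 2))), hμmem v⟩,
        hμc.subtype_mk _⟩ with hL₁'
    have hKer : ∀ (Z : Type) [TopologicalSpace Z] (ψ : C(E, Z)),
        (∃ z₀ : Z, (ψ.comp L₁').Homotopic (ContinuousMap.const (sphere (0 : EuclideanSpace ℝ (Fin 2)) 1) z₀)) →
        ∀ (a : E) (γ : Path a a), (γ.map ψ.continuous).Homotopic (Path.refl (ψ a)) :=
      fun Z _ ψ hψ a γ => helper_friendsPi1_G2 k K₁ g₁ G₁ hK hg hG (helper_friendsPi1_G1 k) E hE' Z ψ L₁'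
        (fun v => rfl) hψ a γ
    have hL₁'' : ∀ v : sphere (0 : EuclideanSpace ℝ (Fin 2)) 1, ((L₁ v : F) : EuclideanSpace ℝ (Fin 4)) =
        (‖((L₁' v : E) : EuclideanSpace ℝ (Fin 4))‖ ^ 2)⁻¹ • ((L₁' v : E) : EuclideanSpace ℝ (Fin 4)) := fun v => by
      rw [hL₁ v, hccoe, comp_apply, hΨval, hcore v]
      rfl
    exact helper_friendsCarrier_Vk_homotopyClause k K₁ f₁ T hK hf hT E F hE hF L₁' hKer L₁ L₂ hL₁'' hL₂ Z g hgL

end Summit.SmoothPoincare4.SmoothPoincare4.Theorems.DcrGap.MkFriends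

end
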